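import Mathlib
import Summits.MatrixMultiplication.MatrixMultiplication.Theses.FidelityWitnesses
import Literature.Computability.AlgebraicComplexity.BorderRankMatMulTwoHolds

/-!
# `FidelityWitnesses.SixEighthsAtFive` is the `(2,5)` instance of the crux `LinearDefectLaw`

Support item `stmt-MatrixMultiplication-14040` (`M(2,5) ≤ 6`) of route `MatrixMultiplication/FidelityWitnesses`
is, as the route file says, the `(n, r) = (2, 5)` instance of crux `stmt-MatrixMultiplication-14039`
(`LinearDefectLaw : |⟨S,⟨n,n,n⟩⟩|² ≤ (n³ + r − R̲(⟨n,n,n⟩)) · ‖S‖²` for `rank S ≤ r`): with the TREE theorem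
`R̲(⟨2,2,2⟩) = 7` (`Landsberg2005_borderRank_matMulTensor_two_holds`, torus-fixed border apolarity, sorry-free
in `Literature`) the constant is `2³ + 5 − 7 = 6`.  Kernel-checked glue, so that a proof of the crux closes this
item mechanically (`sixEighthsAtFive_of_linearDefectLaw`).
-/

set_option linter.dupNamespace false

namespace Summit.MatrixMultiplication.MatrixMultiplication.Theorems

open scoped BigOperators
open Literature.Computability.AlgebraicComplexity
open Summit.MatrixMultiplication.MatrixMultiplication.Theses.FidelityWitnesses

/-- **`LinearDefectLaw ⇒ SixEighthsAtFive`.** The linear defect law at `(n, r) = (2, 5)` reads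
`|⟨S,⟨2,2,2⟩⟩|² ≤ (8 + 5 − R̲(⟨2,2,2⟩)) · ‖S‖²`, and `R̲(⟨2,2,2⟩) = 7` is a theorem of the tree
(`Landsberg2005_borderRank_matMulTensor_two_holds`), so the constant is `6`. [folklore] -/
theorem sixEighthsAtFive_of_linearDefectLaw (h : LinearDefectLaw) : SixEighthsAtFive := by
  intro S hS
  have key := h 2 5 S hS
  have h7 : algBorderRank (matMulTensor ℂ 2 2 2) = 7 := Landsberg2005_borderRank_matMulTensor_two_holds
  rw [h7] at key
  have hc : ((2 : ℕ) : ℝ) ^ 3 + ((5 : ℕ) : ℝ) - ((7 : ℕ) : ℝ) = 6 := by norm_num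
  rw [hc] at key
  exact key

end Summit.MatrixMultiplication.MatrixMultiplication.Theorems
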